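import Mathlib
import HarnessLib.Audit
import Summits.PneNP.PneNP.Theorems.PstarCoreBoundTargets
import Summits.PneNP.PneNP.Theorems.PstarGSat

/-!
# Fresh gates are erasable, I: the fresh split and the pin (ROUND-24, memo §14.3; ASK T-O2-F «FreshErase»)

FRONTIER range-avoidance ladder, rung F-N3, ROUND 24 (cell `pnp-ideate`, planner memo `r24/CORE-BOUND-NOTES.md` §14.3, ASK T-O2-F of planner p3 g21
(typed sketch `r24/SketchFreshErase.lean`), prover-1 g15 `O2-SCOPING.md` §9 (E2); restricted-model proof complexity — nothing here bears on `P`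
versus `NP`).

A GATE is a monomial output `g = (p, z)` of a constraint touching an AND-private `p` of a chord (excluded by "privates unread").  When the
partner `z` is FRESH (in no output of the core, in neither linear part, in no other monomial) it is an existential switch making `w₁` CONDITIONAL
("`w₁` unless `p` is ON").  `FreshGate`, `eraseGate` are p3's typed setting verbatim; `sat_fresh_split` (toggle `z`): over the equations of any
`E ⊆ J₀`, `(w₁, w₂)` solvable ⟺ gate-erased pair solvable ∨ `w₂ ∧ x_p = 1` solvable; `t3_fresh_split`: (T3) ⟺ erased (T3) ∧ the PIN
"`Sol(J₀) ∧ w₂ ⟹ x_p = 0`"; `pin_of_freshGate`: for a TERMINAL core and `p` an AND variable of a CLEAN `e ∈ J₀` untouched by the monomials of `w₂`,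
the pin holds on the equation of `e` alone — lifting a solution `x₀` of `J₀ ∖ e` to `x₀[p := 1, p′ := κ(x₀)]` (`lift`) solves `J₀` with `p` ON, so
`w₂ ∘ lift = gval C″ G₂ + c` (`bit_gval_lift`) misses its target on `Sol(J₀ ∖ e)`, is CONSTANT by `PstarGSat.gSat`, and `x` is its own lift.
The erasure theorem (`Terminal` is kept when the gate is erased) is `PstarFreshEraseTerminal.terminal_eraseGate`.
-/

set_option linter.dupNamespace false -- `Summit.PneNP.PneNP.…`: summit = sub-problem name (D-0017 single-conjunct layout)

open Finset Literature.Computability.Complexity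
open scoped symmDiff
open Summit.PneNP.PneNP.Theorems.PstarFibrePolys (bit bit_injective)
open Summit.PneNP.PneNP.Theorems.PstarTyped (Typed)
open Summit.PneNP.PneNP.Theorems.PstarSALevel (varSet bdry BoundaryExpanding SimpleOverlap)
open Summit.PneNP.PneNP.Theorems.PstarGapPeeling (not_mem_varSet_of_private eval_update_of_not_mem)
open Summit.PneNP.PneNP.Theorems.PstarCentreFree (vars_mem_varSet)
open Summit.PneNP.PneNP.Theorems.PstarGapOneAll (gval)
open Summit.PneNP.PneNP.Theorems.PstarGConstraint (bit_gval gval_update_of_forall_ne gval_false)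
open Summit.PneNP.PneNP.Theorems.PstarGraphQuadGapTwoForms (sum_symmDiff_zmod2)
open Summit.PneNP.PneNP.Theorems.PstarCoreBound (XorClosed)
open Summit.PneNP.PneNP.Theorems.PstarChordRepair (IsChord)
open Summit.PneNP.PneNP.Theorems.PstarCoreBoundTargets (Terminal)
open Summit.PneNP.PneNP.Theorems.PstarGSat (gSat)

namespace Summit.PneNP.PneNP.Theorems.PstarFreshErase

variable {n m : ℕ}

/-- In `𝔽₂`, `x + x = 0`. -/
private theorem zmod2_add_self (x : ZMod 2) : x + x = 0 := by
  revert x; decide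

/-- Every element of `𝔽₂` is a `bit`. -/
private theorem exists_bit_eq (s : ZMod 2) : ∃ b : Bool, bit b = s := by
  revert s; decide

/-! ## The setting -/

/-- `g` is a GATE of `w₁` on the AND variable `p` with a FRESH single-use partner `z`: `g ∈ G₁` has AND pair `(p, z)`, `z` occurs in no
output of `J₀`, in neither linear part, and in the AND pair of no other monomial output of `w₁, w₂` (and `g ∉ G₂`); the symmetric cases (slots
`2,3` swapped, gate in `w₂`) are the same lemma. -/
def FreshGate (I : LocalMap 4 n m) (J₀ : Finset (Fin m)) (w₁ w₂ : Finset (Fin n) × Finset (Fin m) × Bool) (g : Fin m) (p z : Fin n) :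
    Prop :=
  g ∈ w₁.2.1 ∧ g ∉ w₂.2.1 ∧ I.vars g 2 = p ∧ I.vars g 3 = z ∧ p ≠ z ∧ (∀ j ∈ J₀, z ∉ varSet I j) ∧ z ∉ w₁.1 ∧ z ∉ w₂.1 ∧
    (∀ g' ∈ w₁.2.1 ∪ w₂.2.1, g' ≠ g → I.vars g' 2 ≠ z ∧ I.vars g' 3 ≠ z)

/-- The constraint `w₁` with the gate `g` erased. -/
def eraseGate (w₁ : Finset (Fin n) × Finset (Fin m) × Bool) (g : Fin m) : Finset (Fin n) × Finset (Fin m) × Bool :=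
  (w₁.1, w₁.2.1.erase g, w₁.2.2)

/-! ## `gval` calculus -/
/-- Splitting one monomial off a G-constraint. -/
theorem bit_gval_erase (I : LocalMap 4 n m) (C : Finset (Fin n)) {G : Finset (Fin m)} {g : Fin m} (hg : g ∈ G) (x : Fin n → Bool) :
    bit (gval I C G x) = bit (gval I C (G.erase g) x) + bit (x (I.vars g 2)) * bit (x (I.vars g 3)) := by
  rw [bit_gval, bit_gval, ← sum_erase_add _ _ hg]
  ring

/-- Updating a variable outside the AND pairs of `G` moves `gval` by its linear coefficient. -/
theorem bit_gval_update_lin (I : LocalMap 4 n m) (C : Finset (Fin n)) {G : Finset (Fin m)} (x : Fin n → Bool) {v : Fin n}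
    (hG : ∀ g ∈ G, I.vars g 2 ≠ v ∧ I.vars g 3 ≠ v) (b : Bool) :
    bit (gval I C G (Function.update x v b)) = bit (gval I C G x) + if v ∈ C then bit b + bit (x v) else 0 := by
  rw [bit_gval, bit_gval]
  have hmono : ∑ g ∈ G, bit (Function.update x v b (I.vars g 2)) * bit (Function.update x v b (I.vars g 3)) =
      ∑ g ∈ G, bit (x (I.vars g 2)) * bit (x (I.vars g 3)) :=
    sum_congr rfl fun g hg => by rw [Function.update_of_ne (hG g hg).1, Function.update_of_ne (hG g hg).2]
  have hlin : ∑ w ∈ C, bit (Function.update x v b w) = ∑ w ∈ C, bit (x w) + if v ∈ C then bit b + bit (x v) else 0 := by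
    have key : ∀ w ∈ C, bit (Function.update x v b w) = bit (x w) + if w = v then bit b + bit (x v) else 0 := by
      intro w _
      by_cases h : w = v
      · subst h
        rw [Function.update_self, if_pos rfl]
        have := zmod2_add_self (bit (x w))
        linear_combination -this
      · rw [Function.update_of_ne h, if_neg h, add_zero]
    rw [sum_congr rfl key, sum_add_distrib, sum_ite_eq']
  rw [hlin, hmono]
  ring

/-! ## Consequences of `FreshGate` -/
section Fresh

variable {I : LocalMap 4 n m} {J₀ : Finset (Fin m)} {w₁ w₂ : Finset (Fin n) × Finset (Fin m) × Bool} {g : Fin m} {p z : Fin n}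

/-- `w₁ = (w₁ with g erased) + x_p·x_z`. -/
theorem FreshGate.bit_gval₁ (hF : FreshGate I J₀ w₁ w₂ g p z) (x : Fin n → Bool) :
    bit (gval I w₁.1 w₁.2.1 x) = bit (gval I w₁.1 (w₁.2.1.erase g) x) + bit (x p) * bit (x z) := by
  rw [bit_gval_erase I w₁.1 hF.1, hF.2.2.1, hF.2.2.2.1]

/-- The erased `w₁` does not see `z`. -/
theorem FreshGate.gval_erase_update (hF : FreshGate I J₀ w₁ w₂ g p z) (x : Fin n → Bool) (b : Bool) :
    gval I w₁.1 (w₁.2.1.erase g) (Function.update x z b) = gval I w₁.1 (w₁.2.1.erase g) x :=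
  gval_update_of_forall_ne I x hF.2.2.2.2.2.2.1
    (fun g' hg' => hF.2.2.2.2.2.2.2.2 g' (mem_union_left _ (mem_of_mem_erase hg')) (ne_of_mem_erase hg')) b

/-- `w₂` does not see `z`. -/
theorem FreshGate.gval₂_update (hF : FreshGate I J₀ w₁ w₂ g p z) (x : Fin n → Bool) (b : Bool) :
    gval I w₂.1 w₂.2.1 (Function.update x z b) = gval I w₂.1 w₂.2.1 x :=
  gval_update_of_forall_ne I x hF.2.2.2.2.2.2.2.1
    (fun g' hg' => hF.2.2.2.2.2.2.2.2 g' (mem_union_right _ hg') (fun h => hF.2.1 (h ▸ hg'))) b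

/-- The outputs of `J₀` do not see `z`. -/
theorem FreshGate.eval_update (hF : FreshGate I J₀ w₁ w₂ g p z) {j : Fin m} (hj : j ∈ J₀) (x : Fin n → Bool) (b : Bool) :
    I.eval (Function.update x z b) j = I.eval x j :=
  eval_update_of_not_mem I j x (hF.2.2.2.2.2.1 j hj) b

end Fresh

/-! ## (1) The fresh split -/
/-- **(1) FRESH SPLIT** (pure logic over `gval`): with a fresh single-use gate `(p,z)` in `w₁`, the pair `(w₁, w₂)` is solvable over the
equations of `E ⊆ J₀` iff EITHER the gate-erased pair is, OR `w₂` together with the unit pin `x_p = 1` is. -/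
theorem sat_fresh_split (I : LocalMap 4 n m) {J₀ E : Finset (Fin m)} (hE : E ⊆ J₀) (y : Fin m → Bool)
    {w₁ w₂ : Finset (Fin n) × Finset (Fin m) × Bool} {g : Fin m} {p z : Fin n} (hF : FreshGate I J₀ w₁ w₂ g p z) :
    (∃ x : Fin n → Bool, (∀ j ∈ E, I.eval x j = y j) ∧ gval I w₁.1 w₁.2.1 x = w₁.2.2 ∧ gval I w₂.1 w₂.2.1 x = w₂.2.2) ↔
    ((∃ x : Fin n → Bool, (∀ j ∈ E, I.eval x j = y j) ∧ gval I w₁.1 (w₁.2.1.erase g) x = w₁.2.2 ∧ gval I w₂.1 w₂.2.1 x = w₂.2.2) ∨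
     (∃ x : Fin n → Bool, (∀ j ∈ E, I.eval x j = y j) ∧ x p = true ∧ gval I w₂.1 w₂.2.1 x = w₂.2.2)) := by
  have hpz : p ≠ z := hF.2.2.2.2.1
  constructor
  · rintro ⟨x, hx, h1, h2⟩
    by_cases hp : x p = true
    · exact Or.inr ⟨x, hx, hp, h2⟩
    · refine Or.inl ⟨x, hx, ?_, h2⟩
      have h := hF.bit_gval₁ x
      rw [Bool.eq_false_iff.2 hp] at h
      apply bit_injective
      rw [← h1, h]; simp [bit]
  · rintro (⟨x, hx, h1, h2⟩ | ⟨x, hx, hp, h2⟩)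
    · -- switch the gate off
      refine ⟨Function.update x z false, fun j hj => by rw [hF.eval_update (hE hj)]; exact hx j hj, ?_, by rw [hF.gval₂_update]; exact h2⟩
      apply bit_injective
      rw [hF.bit_gval₁, hF.gval_erase_update, h1, Function.update_self, Function.update_of_ne hpz]
      simp [bit]
    · -- `p` is ON: choose `z` to fix `w₁`
      by_cases hc : gval I w₁.1 (w₁.2.1.erase g) x = w₁.2.2
      · refine ⟨Function.update x z false, fun j hj => by rw [hF.eval_update (hE hj)]; exact hx j hj, ?_,
          by rw [hF.gval₂_update]; exact h2⟩
        apply bit_injective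
        rw [hF.bit_gval₁, hF.gval_erase_update, hc, Function.update_self, Function.update_of_ne hpz]
        simp [bit]
      · refine ⟨Function.update x z true, fun j hj => by rw [hF.eval_update (hE hj)]; exact hx j hj, ?_,
          by rw [hF.gval₂_update]; exact h2⟩
        apply bit_injective
        rw [hF.bit_gval₁, hF.gval_erase_update, Function.update_self, Function.update_of_ne hpz, hp]
        have e : ∀ a b : Bool, a ≠ b → bit a + bit true * bit true = bit b := by decide
        exact e _ _ hc

/-- **(1′)** hence (T3) splits into the gate-erased (T3) AND the pin implication "`J₀ ∧ w₂ ⇒ x_p = 0`". -/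
theorem t3_fresh_split (I : LocalMap 4 n m) {J₀ : Finset (Fin m)} (y : Fin m → Bool)
    {w₁ w₂ : Finset (Fin n) × Finset (Fin m) × Bool} {g : Fin m} {p z : Fin n} (hF : FreshGate I J₀ w₁ w₂ g p z) :
    (¬ ∃ x : Fin n → Bool, (∀ j ∈ J₀, I.eval x j = y j) ∧ gval I w₁.1 w₁.2.1 x = w₁.2.2 ∧ gval I w₂.1 w₂.2.1 x = w₂.2.2) ↔
    ((¬ ∃ x : Fin n → Bool, (∀ j ∈ J₀, I.eval x j = y j) ∧ gval I w₁.1 (w₁.2.1.erase g) x = w₁.2.2 ∧ gval I w₂.1 w₂.2.1 x = w₂.2.2) ∧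
     (∀ x : Fin n → Bool, (∀ j ∈ J₀, I.eval x j = y j) → gval I w₂.1 w₂.2.1 x = w₂.2.2 → x p = false)) := by
  have hsplit := sat_fresh_split I (Subset.refl J₀) y hF
  constructor
  · intro hT3
    refine ⟨fun h => hT3 (hsplit.2 (Or.inl h)), fun x hx h2 => ?_⟩
    by_contra hp
    rw [Bool.eq_false_iff, not_not] at hp
    exact hT3 (hsplit.2 (Or.inr ⟨x, hx, hp, h2⟩))
  · rintro ⟨hT3', hpin⟩ ⟨x, hx, h1, h2⟩
    have hp := hpin x hx h2
    refine hT3' ⟨x, hx, ?_, h2⟩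
    have h := hF.bit_gval₁ x
    rw [hp] at h
    apply bit_injective
    rw [← h1, h]; simp [bit]

/-! ## (2★) The pin on the equation of `e` alone -/
section Pin

variable {I : LocalMap 4 n m} {e : Fin m} {p p' : Fin n}

/-- `bit true = 1`. -/
private theorem bit_true : bit true = 1 := rfl

/-- The AND pair of `e` is `{p, p'}` in some order: slot distinctness. -/
theorem slots_ne (hI : I.IsPure xorAndPred) (hpp : (I.vars e 2 = p ∧ I.vars e 3 = p') ∨ (I.vars e 2 = p' ∧ I.vars e 3 = p)) :
    I.vars e 0 ≠ I.vars e 1 ∧ I.vars e 0 ≠ p ∧ I.vars e 0 ≠ p' ∧ I.vars e 1 ≠ p ∧ I.vars e 1 ≠ p' := by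
  have hinj := hI.2 e
  rcases hpp with ⟨h2, h3⟩ | ⟨h2, h3⟩ <;> subst h2 <;> subst h3 <;>
    exact ⟨fun h => absurd (hinj h) (by decide), fun h => absurd (hinj h) (by decide), fun h => absurd (hinj h) (by decide),
      fun h => absurd (hinj h) (by decide), fun h => absurd (hinj h) (by decide)⟩

/-- The equation of `e` in bits: `out_e = x_u + x_v + x_p·x_{p'}`. -/
theorem bit_eval_e (hI : I.IsPure xorAndPred) (hpp : (I.vars e 2 = p ∧ I.vars e 3 = p') ∨ (I.vars e 2 = p' ∧ I.vars e 3 = p))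
    (x : Fin n → Bool) : bit (I.eval x e) = bit (x (I.vars e 0)) + bit (x (I.vars e 1)) + bit (x p) * bit (x p') := by
  rw [PstarPDT.bit_eval hI x e]
  rcases hpp with ⟨h2, h3⟩ | ⟨h2, h3⟩
  · rw [h2, h3]
  · rw [h2, h3, mul_comm]

/-- the value `x_u + x_v + y_e` that `p'` must take when `p` is ON -/
def kap (I : LocalMap 4 n m) (y : Fin m → Bool) (e : Fin m) (x : Fin n → Bool) : Bool :=
  xor (xor (x (I.vars e 0)) (x (I.vars e 1))) (y e)

/-- `kap` in bits. -/
theorem bit_kap (I : LocalMap 4 n m) (y : Fin m → Bool) (e : Fin m) (x : Fin n → Bool) :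
    bit (kap I y e x) = bit (x (I.vars e 0)) + bit (x (I.vars e 1)) + bit (y e) := by
  unfold kap
  rw [PstarFibrePolys.bit_xor, PstarFibrePolys.bit_xor]

/-- the LIFT `x₀[p := 1, p' := κ(x₀)]` -/
def lift (I : LocalMap 4 n m) (y : Fin m → Bool) (e : Fin m) (p p' : Fin n) (x₀ : Fin n → Bool) : Fin n → Bool :=
  Function.update (Function.update x₀ p true) p' (kap I y e x₀)

/-- The lift has `p` ON. -/
theorem lift_p (hne : p ≠ p') (y : Fin m → Bool) (x₀ : Fin n → Bool) : lift I y e p p' x₀ p = true := by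
  unfold lift
  rw [Function.update_of_ne hne, Function.update_self]

/-- The lift satisfies the equation of `e`. -/
theorem eval_lift (hI : I.IsPure xorAndPred) (hpp : (I.vars e 2 = p ∧ I.vars e 3 = p') ∨ (I.vars e 2 = p' ∧ I.vars e 3 = p))
    (hne : p ≠ p') (y : Fin m → Bool) (x₀ : Fin n → Bool) : I.eval (lift I y e p p' x₀) e = y e := by
  obtain ⟨-, h0p, h0p', h1p, h1p'⟩ := slots_ne hI hpp
  apply bit_injective
  rw [bit_eval_e hI hpp, lift_p hne]
  unfold lift
  rw [Function.update_self, Function.update_of_ne h0p', Function.update_of_ne h0p, Function.update_of_ne h1p',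
    Function.update_of_ne h1p, bit_kap, bit_true, one_mul]
  have := zmod2_add_self (bit (x₀ (I.vars e 0)) + bit (x₀ (I.vars e 1)))
  linear_combination this

/-- A point with `p` ON satisfying the equation of `e` IS its own lift. -/
theorem lift_eq_self (hI : I.IsPure xorAndPred) (hpp : (I.vars e 2 = p ∧ I.vars e 3 = p') ∨ (I.vars e 2 = p' ∧ I.vars e 3 = p))
    (y : Fin m → Bool) {x : Fin n → Bool} (hxe : I.eval x e = y e) (hp : x p = true) : lift I y e p p' x = x := by
  have hx : Function.update x p true = x := Function.update_eq_self_iff.2 hp.symm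
  unfold lift
  rw [hx]
  refine Function.update_eq_self_iff.2 ?_
  apply bit_injective
  have h := bit_eval_e hI hpp x
  rw [hxe, hp, bit_true, one_mul] at h
  rw [bit_kap]
  have e2 : ∀ a b c d : ZMod 2, a = b + c + d → b + c + a = d := by decide
  exact e2 _ _ _ _ h

/-- the linear part of `w₂ ∘ lift`: `C″ = (C ∖ {p, p'}) ∆ ([p' ∈ C]·{u, v})` -/
def liftC (I : LocalMap 4 n m) (e : Fin m) (p p' : Fin n) (C : Finset (Fin n)) : Finset (Fin n) :=
  ((C.erase p).erase p') ∆ (if p' ∈ C then {I.vars e 0, I.vars e 1} else ∅)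

/-- the constant of `w₂ ∘ lift`: `c = [p ∈ C] + [p' ∈ C]·y_e` -/
def liftc (C : Finset (Fin n)) (p p' : Fin n) (y : Fin m → Bool) (e : Fin m) : ZMod 2 :=
  (if p ∈ C then 1 else 0) + if p' ∈ C then bit (y e) else 0

/-- `p, p'` do not occur in `C″`. -/
theorem not_mem_liftC (hI : I.IsPure xorAndPred) (hpp : (I.vars e 2 = p ∧ I.vars e 3 = p') ∨ (I.vars e 2 = p' ∧ I.vars e 3 = p))
    (C : Finset (Fin n)) : p ∉ liftC I e p p' C ∧ p' ∉ liftC I e p p' C := by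
  obtain ⟨-, h0p, h0p', h1p, h1p'⟩ := slots_ne hI hpp
  unfold liftC
  refine ⟨fun h => ?_, fun h => ?_⟩
  · rcases Finset.mem_symmDiff.1 h with ⟨h1, -⟩ | ⟨h1, -⟩
    · exact notMem_erase p C (mem_of_mem_erase h1)
    · split_ifs at h1 with hc
      · rcases mem_insert.1 h1 with h | h
        · exact h0p h.symm
        · exact h1p (mem_singleton.1 h).symm
      · exact notMem_empty _ h1
  · rcases Finset.mem_symmDiff.1 h with ⟨h1, -⟩ | ⟨h1, -⟩
    · exact notMem_erase p' _ h1
    · split_ifs at h1 with hc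
      · rcases mem_insert.1 h1 with h | h
        · exact h0p' h.symm
        · exact h1p' (mem_singleton.1 h).symm
      · exact notMem_empty _ h1

/-- **`w₂ ∘ lift` is the G-constraint `(C″, G₂)` plus the constant `c`**, for monomials `G` avoiding `p, p'`. -/
theorem bit_gval_lift (hI : I.IsPure xorAndPred) (hpp : (I.vars e 2 = p ∧ I.vars e 3 = p') ∨ (I.vars e 2 = p' ∧ I.vars e 3 = p))
    (hne : p ≠ p') (y : Fin m → Bool) (C : Finset (Fin n)) {G : Finset (Fin m)}
    (hG : ∀ g ∈ G, (I.vars g 2 ≠ p ∧ I.vars g 3 ≠ p) ∧ (I.vars g 2 ≠ p' ∧ I.vars g 3 ≠ p')) (x₀ : Fin n → Bool) :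
    bit (gval I C G (lift I y e p p' x₀)) = bit (gval I (liftC I e p p' C) G x₀) + liftc C p p' y e := by
  classical
  obtain ⟨h01, -, -, -, -⟩ := slots_ne hI hpp
  have hsplit : ∑ w ∈ C, bit (x₀ w) = ∑ w ∈ (C.erase p).erase p', bit (x₀ w) + (if p ∈ C then bit (x₀ p) else 0) +
      (if p' ∈ C then bit (x₀ p') else 0) := by
    by_cases hp : p ∈ C
    · rw [if_pos hp, ← sum_erase_add _ _ hp]
      by_cases hp' : p' ∈ C
      · rw [if_pos hp', ← sum_erase_add _ _ (mem_erase.2 ⟨hne.symm, hp'⟩)]; ring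
      · rw [if_neg hp', erase_eq_of_notMem (fun h => hp' (mem_of_mem_erase h))]; ring
    · rw [if_neg hp, erase_eq_of_notMem hp]
      by_cases hp' : p' ∈ C
      · rw [if_pos hp', ← sum_erase_add _ _ hp']; ring
      · rw [if_neg hp', erase_eq_of_notMem hp']; ring
  -- peel the two updates
  unfold lift
  rw [bit_gval_update_lin I C _ (fun g hg => (hG g hg).2), bit_gval_update_lin I C _ (fun g hg => (hG g hg).1),
    Function.update_of_ne hne.symm, bit_kap, bit_true, bit_gval, bit_gval, hsplit]
  unfold liftC liftc
  rw [sum_symmDiff_zmod2]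
  generalize ∑ w ∈ (C.erase p).erase p', bit (x₀ w) = S
  generalize ∑ g ∈ G, bit (x₀ (I.vars g 2)) * bit (x₀ (I.vars g 3)) = M
  generalize bit (x₀ p) = A
  generalize bit (x₀ p') = A'
  generalize bit (y e) = Y
  by_cases hp : p ∈ C <;> by_cases hp' : p' ∈ C <;>
    simp only [hp, hp', if_true, if_false, sum_empty, sum_pair h01, add_zero] <;>
    · generalize bit (x₀ (I.vars e 0)) = U
      generalize bit (x₀ (I.vars e 1)) = V
      revert S M A A' Y U V
      decide

end Pin

/-- **(2★) THE PIN on the equation of `e` alone.**  For a terminal core with a fresh gate `(p, z)` on an AND variable `p` of a CLEAN output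
`e ∈ J₀` whose AND pair no monomial of `w₂` touches: the equation of `e` and `w₂` already force `x_p = 0` (from `t3_fresh_split` and
`PstarGSat.gSat` on `J₀ ∖ e`). -/
theorem pin_of_freshGate {r : ℕ} (I : LocalMap 4 n m) (hI : I.IsPure xorAndPred) (hT : Typed I) (hS : SimpleOverlap I)
    (hB : BoundaryExpanding r I) {y : Fin m → Bool} {J₀ : Finset (Fin m)} {w₁ w₂ : Finset (Fin n) × Finset (Fin m) × Bool}
    {g e : Fin m} {p z : Fin n} (hF : FreshGate I J₀ w₁ w₂ g p z) (he : e ∈ J₀) (hpe : I.vars e 2 = p ∨ I.vars e 3 = p)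
    (hne : I.vars e 2 ≠ I.vars e 3) (hclean : IsChord I J₀ e)
    (halone : ∀ g' ∈ w₂.2.1, ∀ s : Fin 4, 2 ≤ s.val → I.vars g' s ≠ I.vars e 2 ∧ I.vars g' s ≠ I.vars e 3)
    (ht : Terminal I r y J₀ w₁ w₂) :
    ∀ x : Fin n → Bool, I.eval x e = y e → gval I w₂.1 w₂.2.1 x = w₂.2.2 → x p = false := by
  classical
  -- name the other AND variable of `e`
  obtain ⟨p', hpp⟩ : ∃ p', (I.vars e 2 = p ∧ I.vars e 3 = p') ∨ (I.vars e 2 = p' ∧ I.vars e 3 = p) := by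
    rcases hpe with h | h
    · exact ⟨_, Or.inl ⟨h, rfl⟩⟩
    · exact ⟨_, Or.inr ⟨rfl, h⟩⟩
  have hne' : p ≠ p' := by
    rcases hpp with ⟨h2, h3⟩ | ⟨h2, h3⟩
    · rw [← h2, ← h3]; exact hne
    · rw [← h2, ← h3]; exact hne.symm
  have hpv : p ∈ varSet I e ∧ p' ∈ varSet I e := by
    rcases hpp with ⟨h2, h3⟩ | ⟨h2, h3⟩
    · exact ⟨h2 ▸ vars_mem_varSet I e 2, h3 ▸ vars_mem_varSet I e 3⟩
    · exact ⟨h3 ▸ vars_mem_varSet I e 3, h2 ▸ vars_mem_varSet I e 2⟩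
  have hpb : p ∈ bdry I J₀ ∧ p' ∈ bdry I J₀ := by
    rcases hpp with ⟨h2, h3⟩ | ⟨h2, h3⟩
    · exact ⟨h2 ▸ hclean.1, h3 ▸ hclean.2⟩
    · exact ⟨h3 ▸ hclean.2, h2 ▸ hclean.1⟩
  have hG₂ : ∀ g' ∈ w₂.2.1, (I.vars g' 2 ≠ p ∧ I.vars g' 3 ≠ p) ∧ (I.vars g' 2 ≠ p' ∧ I.vars g' 3 ≠ p') := by
    intro g' hg'
    have h2 := halone g' hg' 2 (by decide)
    have h3 := halone g' hg' 3 (by decide)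
    rcases hpp with ⟨hp2, hp3⟩ | ⟨hp2, hp3⟩
    · rw [hp2, hp3] at h2 h3; exact ⟨⟨h2.1, h3.1⟩, ⟨h2.2, h3.2⟩⟩
    · rw [hp2, hp3] at h2 h3; exact ⟨⟨h2.2, h3.2⟩, ⟨h2.1, h3.1⟩⟩
  obtain ⟨-, -, hJr, -, hdj₂, -, hT3, hM0⟩ := ht
  -- the pin on `Sol(J₀)`
  have hpin := ((t3_fresh_split I y hF).1 hT3).2
  -- lifts of solutions of `J₀ ∖ e` solve `J₀`
  have hliftSol : ∀ x₀ : Fin n → Bool, (∀ j ∈ J₀.erase e, I.eval x₀ j = y j) → ∀ j ∈ J₀, I.eval (lift I y e p p' x₀) j = y j := by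
    intro x₀ hx₀ j hj
    by_cases hje : j = e
    · rw [hje]; exact eval_lift hI hpp hne' y x₀
    · have hpj : p ∉ varSet I j := not_mem_varSet_of_private I he hj hje hpb.1 hpv.1
      have hp'j : p' ∉ varSet I j := not_mem_varSet_of_private I he hj hje hpb.2 hpv.2
      unfold lift
      rw [eval_update_of_not_mem I j _ hp'j, eval_update_of_not_mem I j _ hpj]
      exact hx₀ j (mem_erase.2 ⟨hje, hj⟩)
  -- hence `w₂ ∘ lift = (C″, G₂) + c` misses its target on `Sol(J₀ ∖ e)`
  obtain ⟨b₀, hb₀⟩ := exists_bit_eq (bit w₂.2.2 + liftc w₂.1 p p' y e)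
  have hcc := zmod2_add_self (liftc w₂.1 p p' y e)
  have hmiss : ∀ x₀ : Fin n → Bool, (∀ j ∈ J₀.erase e, I.eval x₀ j = y j) → gval I (liftC I e p p' w₂.1) w₂.2.1 x₀ ≠ b₀ := by
    intro x₀ hx₀ hb
    have hw₂ : gval I w₂.1 w₂.2.1 (lift I y e p p' x₀) = w₂.2.2 := by
      apply bit_injective
      rw [bit_gval_lift hI hpp hne' y w₂.1 hG₂ x₀, hb, hb₀]
      linear_combination hcc
    have h := hpin (lift I y e p p' x₀) (hliftSol x₀ hx₀) hw₂
    rw [lift_p hne'] at h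
    exact Bool.noConfusion h
  -- by `gSat` the G-constraint `(C″, G₂)` is constant
  have hconst : ∀ x x' : Fin n → Bool, gval I (liftC I e p p' w₂.1) w₂.2.1 x = gval I (liftC I e p p' w₂.1) w₂.2.1 x' := by
    intro x x'
    by_contra hxx
    have hJr' : (J₀.erase e).card ≤ r := (card_le_card (erase_subset e J₀)).trans hJr.le
    obtain ⟨x₀, hx₀, hb⟩ := gSat n m r I hI hT hB hS y (J₀.erase e) w₂.2.1 (liftC I e p p' w₂.1) b₀ hJr'
      (hdj₂.mono_left (erase_subset e J₀)) ⟨x, x', hxx⟩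
    exact hmiss x₀ hx₀ hb
  -- a solution of `J₀ ∖ e` exists (M0 at `e`); the target point is its own lift
  obtain ⟨x₀, hx₀, -, -⟩ := hM0 e he
  intro x hxe hx2
  by_contra hp
  rw [Bool.eq_false_iff, not_not] at hp
  have h1 := bit_gval_lift hI hpp hne' y w₂.1 hG₂ x
  rw [lift_eq_self hI hpp y hxe hp, hx2, hconst x x₀] at h1
  refine hmiss x₀ hx₀ (bit_injective ?_)
  rw [hb₀, h1]
  linear_combination -hcc

end Summit.PneNP.PneNP.Theorems.PstarFreshErase
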